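import Literature.MathematicalPhysics.QuantumFieldTheory.Balaban1983to89.B7Prop2SpecialUnitary
import Literature.MathematicalPhysics.QuantumFieldTheory.Balaban1983to89.B8Eq184Proof

/-!
# `Balaban1983to89.B8SpecialUnitaryTrace` — [Balaban1985RegularSpaces] p. 76 for `G = SU(N)`: the trace functional `tr` on `M_N(ℂ)` is the `τ`
# of the trace-free thread (sub-row «G-B8-T2S», JOINT J-SU layer 3b: the `M_N(ℂ)` facts (T1), (G1)–(G3) and the exit «`u·e^{iλ′} ∈ SU(N)`»)

statement-level skeleton of published theorems with citation tags; proofs where landed; nothing here is a claim about the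
Yang–Mills mass gap

T. Bałaban, *Spaces of regular gauge field configurations on a lattice and gauge fixing conditions*, Commun. Math. Phys. **99** (1985)
75–102 `[Balaban1985RegularSpaces]` ("B8"), p. 76: «gauge fields … with values in `G = SU(N)` … functions with values in its Lie algebra `𝔤`»,
(1.17) p. 78, (1.77) p. 90 (`u′ = e^{iλ}`).  T. Bałaban, *Averaging operations for lattice gauge theories*, Commun. Math. Phys. **98** (1985) 17–51
`[Balaban1985Averaging]` ("[3]"), p. 20 («the group `G` is obtained by applying the function `e^{iA}` to `A ∈ 𝔤`»), (19)–(23) p. 21.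
STATUS: published, refereed.

CITATION HEADER (lean-in-tree rule).  Cell `lit-balaban`, seat `lit-balaban-t2s-1` (gen 0), sub-row «G-B8-T2S» (R3 `stmt-QuantumFields-19200`),
JOINT J-SU layer 3b (`lit-balaban-t2s-1/J-SU-ROADMAP.md`).  WHAT IS REPRODUCED.  The abstract trace-free thread (`B8Prop5TraceFree` …
`B8SectETraceFree`) is parametrised by a continuous `ℂ`-linear tracial `τ` and, at the socket level, by a subgroup `G` with (G1) `G ≤ U(𝔸)`,
(G2) `τ(log g) = 0` for `g ∈ G` near `1`, (G3) `e^{X} ∈ G` for skew `τ`-free `X`.  THIS FILE supplies these for `𝔸 = M_N(ℂ)` (operator norm of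
the scope `Matrix.Norms.L2Operator`, the tree's convention — `B7Prop2SpecialUnitary`), `τ = tr` (`trCLM`), `G = SU(N)` (`specialUnitaryUnits`):
* `trCLM`, `trCLM_apply`, (T1) `trCLM_mul_comm`;
* (G1) is `B7Prop2SpecialUnitary.specialUnitaryUnits_le_unitaryUnits` (tree); (G2) `trCLM_mlog_eq_zero_of_mem` — `tr log g = 0` for `g ∈ SU(N)`,
  `‖g − 1‖ ≤ ⅓`, `N‖g − 1‖ < π` (= `ExpMeanLog.trace_mlog_eq_zero`; the `N`-dependence cannot be dropped: `e^{2πi/N}·1`, loc. cit.);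
* (G3) `expUnit_I_smul_mem_specialUnitaryUnits` — `e^{iY} ∈ SU(N)` for Hermitian `Y`, `tr Y = 0` (`det e^{X} = e^{tr X}`, `Literature.Analysis.Matrix.det_exp_eq_exp_trace`);
* ★ the EXIT of the thread: `gaugeExp_mem_specialUnitaryUnits` (`e^{iλ(x)} ∈ SU(N)` for Hermitian trace-free `λ(x)`) and `mul_gaugeExp_mem_specialUnitaryUnits`
  (`u(x)e^{iλ(x)} ∈ SU(N)` for `u(x) ∈ SU(N)`) — Theorem 4's `v = u₁e^{iλ′}` is `SU(N)`-valued once `λ′` is Hermitian AND trace-free, which is what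
  `B8SectETraceFree.hFP_kLevel_of_sectE_local'_RD_traceFree` delivers at `τ = trCLM`.

HONEST SCOPE.  Finite-dimensional linear algebra; no new analysis.  Count-neutral; N05 ∕ `stub_PV3A` NOT discharged; nothing continuum ∕ ℝ⁴ ∕ OS ∕
mass-gap ∕ Clay.  No `sorry`, no `… : Prop` fact, no `instance` (the C⋆-structure on `M_N(ℂ)` is the scoped one, introduced by `letI` inside proofs
as in `B7Prop2SpecialUnitary`), no `notation`.
-/

noncomputable section

open scoped Matrix.Norms.L2Operator
open NormedSpace
open Complex (I)

namespace Literature.MathematicalPhysics.QuantumFieldTheory.Balaban1983to89.B8SpecialUnitaryTrace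

open MatrixLog (mlog)
open B7Prop1Explicit (expUnit val_expUnit)
open B7Prop2Explicit (unitaryUnits mem_unitaryUnits)
open B7Prop2SpecialUnitary (specialUnitaryUnits mem_specialUnitaryUnits specialUnitaryUnits_le_unitaryUnits)
open B8Eq184Proof (gaugeExp)

-- `Site` alone could resolve to the torus sites of `Setup.lean`; re-export the `ℤ^d` sites of `B7Prop1Explicit`.
export B7Prop1Explicit (Site)

variable {d : ℕ} {n : Type*} [Fintype n]

variable (n) in
/-- **The trace as a continuous `ℂ`-linear functional on `M_N(ℂ)`** (finite dimension; operator norm of `Matrix.Norms.L2Operator`) — the `τ` of the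
trace-free thread for `G = SU(N)` (print: `𝔤 = 𝔰𝔲(N)`, the traceless anti-Hermitian ∕ — after the factor `i` — Hermitian matrices).
[cite: Balaban1985RegularSpaces, p.76, (1.17) p.78; Balaban1985Averaging, p.20] -/
abbrev trCLM : Matrix n n ℂ →L[ℂ] ℂ := LinearMap.toContinuousLinearMap (Matrix.traceLinearMap n ℂ ℂ)

/-- `trCLM M = tr M`. [cite: Balaban1985RegularSpaces, p.76] -/
@[simp] theorem trCLM_apply (M : Matrix n n ℂ) : trCLM n M = M.trace := rfl

/-- **(T1)** the trace is tracial: `tr(xy) = tr(yx)`. [cite: Balaban1985Averaging, (20) p.21] -/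
theorem trCLM_mul_comm (x y : Matrix n n ℂ) : trCLM n (x * y) = trCLM n (y * x) := by
  rw [trCLM_apply, trCLM_apply]
  exact Matrix.trace_mul_comm x y

variable [DecidableEq n]

/-- **(G2) for `SU(N)`**: `tr log g = 0` for `g ∈ SU(N)` with `‖g − 1‖ ≤ ⅓` and `N‖g − 1‖ < π` (`e^{tr log g} = det g = 1`, `|tr log g| < 2π`;
`ExpMeanLog.trace_mlog_eq_zero`).  The `N`-window cannot be dropped (`e^{2πi/N}·1 ∈ SU(N)`). [cite: Balaban1985Averaging, (20)–(23) p.21, p.20] -/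
theorem trCLM_mlog_eq_zero_of_mem {g : (Matrix n n ℂ)ˣ} (hg : g ∈ specialUnitaryUnits n)
    (hs : ‖(g : Matrix n n ℂ) - 1‖ ≤ 1 / 3) (hπ : Fintype.card n * ‖(g : Matrix n n ℂ) - 1‖ < Real.pi) :
    trCLM n (mlog (g : Matrix n n ℂ)) = 0 := by
  rw [trCLM_apply]
  exact ExpMeanLog.trace_mlog_eq_zero (mem_specialUnitaryUnits.1 hg) hs hπ

/-- **(G3) for `SU(N)`**: `e^{iY} ∈ SU(N)` for Hermitian `Y` with `tr Y = 0` — unitary because `iY` is skew (`[3] (22)–(23)`; tree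
`B8Ineq170.exp_I_smul_mem_unitary`), `det e^{iY} = e^{i·tr Y} = 1` (Liouville). [cite: Balaban1985Averaging, p.20, (22)–(23) p.21] -/
theorem expUnit_I_smul_mem_specialUnitaryUnits {Y : Matrix n n ℂ} (hY : IsSelfAdjoint Y) (htr : Y.trace = 0) :
    expUnit (I • Y) ∈ specialUnitaryUnits n := by
  letI : CStarAlgebra (Matrix n n ℂ) := {}
  rw [mem_specialUnitaryUnits, Matrix.mem_specialUnitaryGroup_iff]
  refine ⟨?_, ?_⟩
  · rw [val_expUnit]
    exact B8Ineq170.exp_I_smul_mem_unitary hY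
  · rw [val_expUnit, Literature.Analysis.Matrix.det_exp_eq_exp_trace, Matrix.trace_smul, htr, smul_zero, exp_zero]

/-- **`e^{iλ} ∈ SU(N)` for Hermitian trace-free `λ`** — the gauge function `u′ = e^{iλ}` of (1.77) is `SU(N)`-valued when `λ` is `𝔰𝔲(N)`-valued
(Hermitian convention). [cite: Balaban1985RegularSpaces, (1.77) p.90, p.76; Balaban1985Averaging, p.20] -/
theorem gaugeExp_mem_specialUnitaryUnits {lam : Site d → Matrix n n ℂ} (hsa : ∀ x, IsSelfAdjoint (lam x))
    (htr : ∀ x, trCLM n (lam x) = 0) (x : Site d) : gaugeExp lam x ∈ specialUnitaryUnits n := by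
  rw [gaugeExp]
  exact expUnit_I_smul_mem_specialUnitaryUnits (hsa x) (htr x)

/-- ★ **THE EXIT OF THE TRACE-FREE THREAD: `u(x)·e^{iλ(x)} ∈ SU(N)`** for `u(x) ∈ SU(N)` and `λ(x)` Hermitian with `tr λ(x) = 0` — Theorem 4's
`v = u₁e^{iλ′}` is `SU(N)`-valued once Proposition 5's `λ′` is Hermitian and trace-free (`B8SectETraceFree.hFP_kLevel_of_sectE_local'_RD_traceFree` at
`τ = trCLM`). [cite: Balaban1985RegularSpaces, Thm 4 p.88, (1.77) p.90, p.76] -/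
theorem mul_gaugeExp_mem_specialUnitaryUnits {u : Site d → (Matrix n n ℂ)ˣ} (hu : ∀ x, u x ∈ specialUnitaryUnits n)
    {lam : Site d → Matrix n n ℂ} (hsa : ∀ x, IsSelfAdjoint (lam x)) (htr : ∀ x, trCLM n (lam x) = 0) (x : Site d) :
    (u * gaugeExp lam) x ∈ specialUnitaryUnits n := by
  rw [Pi.mul_apply]
  exact (specialUnitaryUnits n).mul_mem (hu x) (gaugeExp_mem_specialUnitaryUnits hsa htr x)

/-- (G1), re-exported for the thread's binder shape: `SU(N)`-valued data are `U(N)`-valued. [cite: Balaban1985Averaging, (19) p.21] -/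
theorem unitary_of_specialUnitary {u : Site d → (Matrix n n ℂ)ˣ} (hu : ∀ x, u x ∈ specialUnitaryUnits n) (x : Site d) :
    u x ∈ unitaryUnits (Matrix n n ℂ) :=
  specialUnitaryUnits_le_unitaryUnits (hu x)

#print axioms mul_gaugeExp_mem_specialUnitaryUnits

end Literature.MathematicalPhysics.QuantumFieldTheory.Balaban1983to89.B8SpecialUnitaryTrace

end
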